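import Literature.MathematicalPhysics.QuantumFieldTheory.Balaban1983to89.B15AveragingHolomorphicLocal
import Literature.MathematicalPhysics.QuantumFieldTheory.Balaban1983to89.B14Eq216Concrete

/-!
# `Balaban1983to89.B15AveragingHolomorphicTowerRegion` — [Balaban1987RG1] = «[I]», (0.1) p. 251, (0.4) p. 253, (0.21) p. 256; [Balaban1988Convergent] = «[III]», (2.2) p. 255,
# (2.11) p. 256; [Balaban1985Variational] = «[15]», Prop. 9 (190) p. 309:
# THE TOWER REGION OF A COARSE BOND IS SATURATED; A GLOBALLY GUARDED PROXY AGREEING WITH `U` ON A TOWER TRANSFERS THE (0.4) GUARD TO `U` ITSELF ALONG THAT TOWER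

Honest framing: statement-level skeleton of published theorems with citation tags; proofs where landed; nothing here is a claim about the
Yang–Mills mass gap.  Cell `pub-ymgap`, HUMAN RULING D-0062 (Track A), seat `pub-ymgap-dag-n12-c` g24 (lane owner N12 = [B15], strategy s1; lane memo
`N12-UNIFORMITY-SPEC.md` §6 «LOCATED-E1-HSB», repair step (r2), plan g91 word I.45435); count-neutral; N12 NOT discharged; finite 𝕋⁴ at fixed ε; nothing continuum ∕ OS ∕
mass-gap ∕ Clay.

WHY.  Step (r1) (`B15AveragingHolomorphicLocal`) proved that the holomorphic iterate `V ↦ iterMh k V c` at a bond `c ∈ bondsIn k Y` of a fine region `Y` SATURATED below `k` is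
ℂ-differentiable at every matrix field agreeing on `bondsIn 0 Y` with `↑U`, `U` an `SU(N)` field (0.4)-guarded ON `Y` ONLY.  The (J0′) producer of N12 reads `iterMh j (·) c` at the
constrained bonds `(j, c)` of `𝐁_k(Z)`; the natural region is the TOWER of `c` — the fine sites of the two `j`-blocks `B^j(c₋) ∪ B^j(c₊)`, i.e. `blockIter j ⁻¹' {c₋, c₊}` with r12's
`j`-fold block map (`B14.Eq22Determines.blockIter`).  THIS MODULE supplies (§1) its lattice bookkeeping — it is a union of `Lʲ`-cubes hence saturated below `j`
(`Node00.toFine_mem_iff_of_isBlockUnion_pow`), `c` is one of its level-`j` bonds, and its fine bonds feed `c` in dag-n12-w4's sense (`B14.Eq216Concrete.feeds`) — and (§2) the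
GUARD TRANSFER: the group-valued averaging of record is two-block local (`Node00.blockAvg_congr_of_eqOn_bondsIn`) and the guard `Small` reads the loop variables in the window only
(`T4ReflectionConeSharp.loopHol_congr₂`), so a GLOBALLY guarded proxy `U_p` (`SmallBelow k U_p`, e.g. the lane's ρ5b tower proxies `N12TowerProxiesOfClass`) that agrees with `U` on
`bondsIn 0 Y` makes `U` ITSELF guarded on `Y` below `k` — the hypothesis `hg` of (r1), with no condition on `U` off the tower.  §3 reads (r1) at the tower region of the bond itself.

CONTENTS (theorems only; no `def`, no `instance`, no `sorry`; axioms standard).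
§1 `mem_preimage_blockIter_pair_iff` · `blockIter_eq_of_cubeIdx_eq` · ★ `isBlockUnion_pow_preimage_blockIter` · ★ `preimage_blockIter_saturated` · `mem_bondsIn_preimage_blockIter_iff` ·
   `self_mem_bondsIn_towerRegion` · `mem_feeds_succ_of_blockIter_src` · ★ `bondsIn_zero_towerRegion_subset_feeds` (positive levels).
§2 `iter_blockAvg_apply_congr_of_eqOn_bondsIn` (group-valued iterate on a saturated region reads the region only) · `small_iff_of_eqOn₂` · `small_iff_of_eqOn_bondsIn` ·
   ★★ `guardOn_of_smallBelow_of_eqOn_bondsIn` (GUARD TRANSFER from a globally guarded proxy) · ★★ `guardOn_towerRegion_of_feedsProxy` (ρ5b's `feeds`-currency ⇒ (r1)'s `hg`-currency) ·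
   `guardOn_towerRegion_zero` (level `0`: vacuous).
§3 ★ `iterMh_coeField_apply_eq_of_guardOn_towerRegion` · ★★ `differentiableAt_iterMh_apply_of_guardOn_towerRegion` · `differentiableAt_iterMh_apply_entry_of_guardOn_towerRegion` ·
   `differentiableAt_iterMh_apply_of_feedsProxy`.
HONEST SCOPE: lattice∕calculus bookkeeping over landed definitions ([folklore]; the (0.4)∕(2.11) cites are locators); nothing of Bałaban's estimates; N12 NOT discharged; the YM mass
gap (Clay) is NOT proved by any of this — R4 closes only the conditional finite-𝕋⁴ rung `BalabanLadder.UV`.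
-/

noncomputable section

namespace Literature.MathematicalPhysics.QuantumFieldTheory.Balaban1983to89.B15AveragingHolomorphicTowerRegion

open Literature.MathematicalPhysics.QuantumFieldTheory.Balaban1983to89.Node00
  (SU coeField coeField_apply SmallBelow blockIter_toFine toFine_mem_iff_of_isBlockUnion_pow blockAvg_congr_of_eqOn_bondsIn)
open T4Continuum BlockAveraging B15DeterminingSets B15AveragingHolomorphic B15AveragingHolomorphicLocal
open ExpMeanLog (expMeanLogSU)
open B10Eq42TorusConstraint (bondsIn mem_bondsIn_iff)
open B10Eq38TorusDomains (toFine)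
open B14.Eq22Determines (blockIter blockIter_succ blockIter_zero)
open B14.Eq216Concrete (feeds feeds_zero mem_feeds_succ)
open scoped Matrix.Norms.L2Operator

/-! ## §1  The tower region `blockIter j ⁻¹' {c₋, c₊}` of a level-`j` bond: saturated, carries `c`, feeds `c` -/

section Region

variable {P : Params} {j : ℕ}

/-- Membership in the tower region of a level-`j` bond: the `j`-block of `x` is `c₋` or `c₊`. [cite: Balaban1987RG1, (0.1) p.251 (bookkeeping)] -/
theorem mem_preimage_blockIter_pair_iff (c : PBond P j) (x : Site P 0) :
    x ∈ blockIter j ⁻¹' ({c.src, c.tgt} : Set (Site P j)) ↔ blockIter j x = c.src ∨ blockIter j x = c.tgt := by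
  rw [Set.mem_preimage, Set.mem_insert_iff, Set.mem_singleton_iff]

/-- Two fine sites in the same `Lʲ`-cube have the same `j`-block (standing range; `B10Eq71TorusOverlap.cubeIdx_eq_blockIter`). [cite: Balaban1987RG1, (0.1) p.252 (bookkeeping)] -/
theorem blockIter_eq_of_cubeIdx_eq (hj : j ≤ P.m + P.K) {x y : Site P 0}
    (h : B3Ineq314Cubes.cubeIdx (P.L ^ j) x = B3Ineq314Cubes.cubeIdx (P.L ^ j) y) : blockIter j x = blockIter j y := by
  rw [B10Eq71TorusOverlap.cubeIdx_eq_blockIter hj x, B10Eq71TorusOverlap.cubeIdx_eq_blockIter hj y] at h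
  funext μ
  exact ZMod.val_injective _ (congrFun h μ)

/-- ★ **A PREIMAGE UNDER THE `j`-FOLD BLOCK MAP IS A UNION OF `Lʲ`-CUBES** (`B10Eq38TorusDomains.IsBlockUnion (L^j)`), for any set of level-`j` sites — in particular the tower region
`blockIter j ⁻¹' {c₋, c₊}`. [cite: Balaban1987RG1, (0.1) p.252; Balaban1988Convergent, (2.2) p.255 (bookkeeping)] -/
theorem isBlockUnion_pow_preimage_blockIter (hj : j ≤ P.m + P.K) (S : Set (Site P j)) :
    B10Eq38TorusDomains.IsBlockUnion (P.L ^ j) (blockIter j ⁻¹' S) := fun _ _ hxy => by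
  rw [Set.mem_preimage, Set.mem_preimage, blockIter_eq_of_cubeIdx_eq hj hxy]

/-- ★ **THE TOWER REGION IS SATURATED BELOW `j`** — the hypothesis `hY` of `B15AveragingHolomorphicLocal` §4 ∕ `Node00.AveragingTwoBlockWindow` §1 at every level `j′ < j`: a union of
`Lʲ`-cubes is a union of `L^{j′+1}`-cubes (`B10Eq71TorusOverlap.isBlockUnion_of_dvd`), hence `Node00.toFine_mem_iff_of_isBlockUnion_pow`. [cite: Balaban1987RG1, (0.1) p.252; Balaban1988Convergent, (2.2) p.255 (bookkeeping)] -/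
theorem preimage_blockIter_saturated (hj : j ≤ P.m + P.K) (S : Set (Site P j)) :
    ∀ j', j' < j → ∀ s : Site P j', toFine j' s ∈ blockIter j ⁻¹' S ↔ toFine (j' + 1) (blockOf s) ∈ blockIter j ⁻¹' S := fun j' hj' s =>
  toFine_mem_iff_of_isBlockUnion_pow (by omega)
    (B10Eq71TorusOverlap.isBlockUnion_of_dvd (pow_dvd_pow P.L hj') (isBlockUnion_pow_preimage_blockIter hj S)) s

/-- The level-`j` bonds of the preimage region are the bonds with both ends in the set (`Node00.blockIter_toFine`). [cite: Balaban1988Convergent, (2.2) p.255 (bookkeeping)] -/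
theorem mem_bondsIn_preimage_blockIter_iff (hj : j ≤ P.m + P.K) (S : Set (Site P j)) (b : PBond P j) :
    b ∈ bondsIn j (blockIter j ⁻¹' S) ↔ b.src ∈ S ∧ b.tgt ∈ S := by
  rw [mem_bondsIn_iff, Set.mem_preimage, Set.mem_preimage, blockIter_toFine j hj, blockIter_toFine j hj]
  rfl

/-- The bond `c` is a level-`j` bond of its own tower region. [cite: Balaban1988Convergent, (2.2) p.255 (bookkeeping)] -/
theorem self_mem_bondsIn_towerRegion (hj : j ≤ P.m + P.K) (c : PBond P j) :
    c ∈ bondsIn j (blockIter j ⁻¹' ({c.src, c.tgt} : Set (Site P j))) :=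
  (mem_bondsIn_preimage_blockIter_iff hj _ c).2 ⟨Or.inl rfl, Or.inr rfl⟩

/-- A fine bond whose source lies in one of the two `(j+1)`-blocks under `c` FEEDS `c` (dag-n12-w4's `feeds (j+1) c`: the bonds issuing from the blocks, iterated; induction on `j`,
through the level-`i` bond `⟨B^i(b₀₋), dir b₀⟩`). [cite: Balaban1988Convergent, (2.11) p.256] -/
theorem mem_feeds_succ_of_blockIter_src :
    ∀ (j : ℕ) (c : PBond P (j + 1)) (b₀ : PBond P 0), (blockIter (j + 1) b₀.src = c.src ∨ blockIter (j + 1) b₀.src = c.tgt) → b₀ ∈ feeds (j + 1) c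
  | 0, c, b₀, h => mem_feeds_succ.2 ⟨b₀, h, by rw [feeds_zero]; exact Set.mem_singleton b₀⟩
  | j + 1, c, b₀, h =>
    mem_feeds_succ.2 ⟨⟨blockIter (j + 1) b₀.src, b₀.dir⟩, h, mem_feeds_succ_of_blockIter_src j _ b₀ (Or.inl rfl)⟩

/-- ★ **THE FINE BONDS OF A POSITIVE-LEVEL TOWER REGION FEED THE BOND**: `bondsIn 0 (blockIter (j+1) ⁻¹' {c₋, c₊}) ⊆ feeds (j+1) c` — so a proxy agreeing with `U` on
`feeds (j+1) c` (ρ5b's currency, `N12TowerProxiesOfClass`) agrees with it on the tower region's fine bonds ((r1)'s currency). [cite: Balaban1988Convergent, (2.11) p.256] -/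
theorem bondsIn_zero_towerRegion_subset_feeds (c : PBond P (j + 1)) :
    bondsIn 0 (blockIter (j + 1) ⁻¹' ({c.src, c.tgt} : Set (Site P (j + 1)))) ⊆ feeds (j + 1) c := fun b₀ hb₀ =>
  mem_feeds_succ_of_blockIter_src j c b₀ ((mem_preimage_blockIter_pair_iff c _).1 ((mem_bondsIn_iff.1 hb₀).1))

end Region

/-! ## §2  The group-valued averaging of record on a saturated region, and the guard transfer from a proxy -/

section Transfer

variable {P : Params} {G : Type*} [GaugeGroup G]

/-- **THE GROUP-VALUED ITERATE ON A SATURATED REGION READS THE REGION ONLY**: for `Y` saturated below `k`, two level-`0` configurations agreeing on `bondsIn 0 Y` have the same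
`Ū^k` at every bond of `bondsIn k Y` (induction on `Node00.blockAvg_congr_of_eqOn_bondsIn`; the group twin of `B15AveragingHolomorphicLocal.iterMh_apply_congr_of_eqOn_bondsIn`).
[cite: Balaban1987RG1, (0.4) p.253, (0.21) p.256; Balaban1988Convergent, (2.11) p.256] -/
theorem iter_blockAvg_apply_congr_of_eqOn_bondsIn (ℰ : LoopAverage G) {Y : Set (Site P 0)} :
    ∀ (k : ℕ), k ≤ P.m + P.K → (∀ j, j < k → ∀ s : Site P j, toFine j s ∈ Y ↔ toFine (j + 1) (blockOf s) ∈ Y) →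
      ∀ {U U' : GaugeField P 0 G}, (∀ b : PBond P 0, b ∈ bondsIn 0 Y → U b = U' b) →
        ∀ c : PBond P k, c ∈ bondsIn k Y →
          Averaging.iter (fun j => blockAvg (P := P) (j := j) ℰ) k U c = Averaging.iter (fun j => blockAvg (P := P) (j := j) ℰ) k U' c
  | 0, _, _, _, _, hUU', c, hc => hUU' c hc
  | k + 1, hk, hY, U, U', hUU', c, hc => by
    show (blockAvg ℰ).avg (Averaging.iter (fun j => blockAvg (P := P) (j := j) ℰ) k U) c =
      (blockAvg ℰ).avg (Averaging.iter (fun j => blockAvg (P := P) (j := j) ℰ) k U') c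
    exact blockAvg_congr_of_eqOn_bondsIn ℰ hk (hY k (Nat.lt_succ_self k))
      (fun b hb => iter_blockAvg_apply_congr_of_eqOn_bondsIn ℰ k (Nat.le_of_succ_le hk) (fun j hj => hY j (Nat.lt_succ_of_lt hj)) hUU' b hb) hc

/-- **THE GUARD READS THE TWO-BLOCK WINDOW ONLY**: two level-`j` configurations agreeing on the bonds with both ends in `B(c₋) ∪ B(c₊)` are (0.4)-small at `c` together
(`T4ReflectionConeSharp.loopHol_congr₂`). [cite: Balaban1987RG1, (0.4) p.253] -/
theorem small_iff_of_eqOn₂ {j : ℕ} (ℰ : LoopAverage G) (hj : j + 1 ≤ P.m + P.K) {U U' : GaugeField P j G} (c : PBond P (j + 1))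
    (hUU' : ∀ b : PBond P j, (blockOf b.src = c.src ∨ blockOf b.src = c.tgt) → (blockOf b.tgt = c.src ∨ blockOf b.tgt = c.tgt) → U b = U' b) :
    Small ℰ U c ↔ Small ℰ U' c := by
  unfold BlockAveraging.Small
  rw [T4ReflectionConeSharp.loopHol_congr₂ hj U U' c hUU']

/-- The same on a region saturated at level `j`: agreement on `bondsIn j Y` gives the same guard at every bond of `bondsIn (j+1) Y`. [cite: Balaban1987RG1, (0.4) p.253 (bookkeeping)] -/
theorem small_iff_of_eqOn_bondsIn {j : ℕ} (ℰ : LoopAverage G) (hj : j + 1 ≤ P.m + P.K) {Y : Set (Site P 0)}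
    (hY : ∀ s : Site P j, toFine j s ∈ Y ↔ toFine (j + 1) (blockOf s) ∈ Y)
    {U U' : GaugeField P j G} (hUU' : ∀ b : PBond P j, b ∈ bondsIn j Y → U b = U' b)
    {c : PBond P (j + 1)} (hc : c ∈ bondsIn (j + 1) Y) : Small ℰ U c ↔ Small ℰ U' c := by
  rw [mem_bondsIn_iff] at hc
  have hblk : ∀ x : Site P j, (blockOf x = c.src ∨ blockOf x = c.tgt) → toFine j x ∈ Y := by
    intro x hx
    refine (hY x).2 ?_
    rcases hx with h | h
    · rw [h]; exact hc.1
    · rw [h]; exact hc.2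
  refine small_iff_of_eqOn₂ ℰ hj c fun b h₁ h₂ => hUU' b ?_
  rw [mem_bondsIn_iff]
  exact ⟨hblk _ h₁, hblk _ h₂⟩

variable {N : ℕ} [NeZero N]

/-- ★★ **GUARD TRANSFER FROM A GLOBALLY GUARDED PROXY.**  Let `Y ⊂ T_η` be saturated below `k`, `U_p` an `SU(N)` configuration guarded below `k` at EVERY coarse bond
(`SmallBelow k U_p`) and `U` a configuration agreeing with `U_p` on `bondsIn 0 Y`.  Then `U` ITSELF is (0.4)-guarded ON `Y` below `k` — `Small (Ū^j U) c` for every `j < k` and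
`c ∈ bondsIn (j+1) Y` —, the hypothesis `hg` of `B15AveragingHolomorphicLocal.differentiableAt_iterMh_apply_of_guardOn`; nothing is asked of `U` off `Y`.  (The iterates agree on
`bondsIn j Y`, and the guard reads the window only.)  The lane's ρ5b proxies (`N12TowerProxiesOfClass`: axial gauge on the tower box of a (2.12)-class configuration, flattened off the
box) are such `U_p`. [cite: Balaban1987RG1, (0.4) p.253, (0.21) p.256; Balaban1988Convergent, (2.11)–(2.12) p.256] -/
theorem guardOn_of_smallBelow_of_eqOn_bondsIn {Y : Set (Site P 0)} (k : ℕ) (hk : k ≤ P.m + P.K)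
    (hY : ∀ j, j < k → ∀ s : Site P j, toFine j s ∈ Y ↔ toFine (j + 1) (blockOf s) ∈ Y)
    {U Up : GaugeField P 0 (SU N)} (hUp : SmallBelow (fun j => blockAvg (P := P) (j := j) expMeanLogSU) k Up)
    (heq : ∀ b : PBond P 0, b ∈ bondsIn 0 Y → Up b = U b) :
    ∀ j, j < k → ∀ c : PBond P (j + 1), c ∈ bondsIn (j + 1) Y →
      Small expMeanLogSU (Averaging.iter (fun j => blockAvg (P := P) (j := j) expMeanLogSU) j U) c := by
  intro j hj c hc
  have hjK : j + 1 ≤ P.m + P.K := by omega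
  have hiter : ∀ b : PBond P j, b ∈ bondsIn j Y →
      Averaging.iter (fun j => blockAvg (P := P) (j := j) expMeanLogSU) j Up b = Averaging.iter (fun j => blockAvg (P := P) (j := j) expMeanLogSU) j U b :=
    iter_blockAvg_apply_congr_of_eqOn_bondsIn expMeanLogSU j (by omega) (fun j' hj' => hY j' (hj'.trans hj)) heq
  exact (small_iff_of_eqOn_bondsIn expMeanLogSU hjK (hY j hj) hiter hc).1 (hUp j hj c)

/-- ★★ **GUARD TRANSFER AT THE TOWER OF A POSITIVE-LEVEL BOND, IN ρ5b's CURRENCY**: a proxy `U_p` with `SmallBelow (j+1) U_p` agreeing with `U` on `feeds (j+1) c` makes `U`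
guarded on the tower region `blockIter (j+1) ⁻¹' {c₋, c₊}` below `j+1` (§1: the region is saturated and its fine bonds feed `c`). [cite: Balaban1987RG1, (0.4) p.253; Balaban1988Convergent, (2.11)–(2.12) p.256] -/
theorem guardOn_towerRegion_of_feedsProxy {j : ℕ} (hj : j + 1 ≤ P.m + P.K) (c : PBond P (j + 1)) {U Up : GaugeField P 0 (SU N)}
    (hUp : SmallBelow (fun j => blockAvg (P := P) (j := j) expMeanLogSU) (j + 1) Up) (heq : ∀ b ∈ feeds (j + 1) c, Up b = U b) :
    ∀ j', j' < j + 1 → ∀ c' : PBond P (j' + 1), c' ∈ bondsIn (j' + 1) (blockIter (j + 1) ⁻¹' ({c.src, c.tgt} : Set (Site P (j + 1)))) →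
      Small expMeanLogSU (Averaging.iter (fun j => blockAvg (P := P) (j := j) expMeanLogSU) j' U) c' :=
  guardOn_of_smallBelow_of_eqOn_bondsIn (j + 1) hj (preimage_blockIter_saturated hj _) hUp
    fun b hb => heq b (bondsIn_zero_towerRegion_subset_feeds c hb)

/-- At level `0` the tower guard is VACUOUS (there is no level below `0`; `feeds 0 c = {c}`). [cite: Balaban1988Convergent, (2.11) p.256 (bookkeeping)] -/
theorem guardOn_towerRegion_zero (c : PBond P 0) (U : GaugeField P 0 (SU N)) :
    ∀ j', j' < 0 → ∀ c' : PBond P (j' + 1), c' ∈ bondsIn (j' + 1) (blockIter 0 ⁻¹' ({c.src, c.tgt} : Set (Site P 0))) →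
      Small expMeanLogSU (Averaging.iter (fun j => blockAvg (P := P) (j := j) expMeanLogSU) j' U) c' :=
  fun j' hj' => absurd hj' (Nat.not_lt_zero j')

end Transfer

/-! ## §3  Step (r1) read at the tower region of the bond itself -/

section AtTower

variable {P : Params} {N : ℕ} [NeZero N] {j : ℕ}

/-- ★ **UNDER THE TOWER GUARD, THE HOLOMORPHIC ITERATE OF `↑U` AT `c` IS THE MATRIX OF `Ū^j U (c)`** (`B15AveragingHolomorphicLocal.iterMh_coeField_apply_eq_of_guardOn` at the tower
region, `c ∈ bondsIn j (blockIter j ⁻¹' {c₋, c₊})`). [cite: Balaban1987RG1, (0.4) p.253, (0.21) p.256] -/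
theorem iterMh_coeField_apply_eq_of_guardOn_towerRegion (hj : j ≤ P.m + P.K) {U : GaugeField P 0 (SU N)} (c : PBond P j)
    (hg : ∀ j', j' < j → ∀ c' : PBond P (j' + 1), c' ∈ bondsIn (j' + 1) (blockIter j ⁻¹' ({c.src, c.tgt} : Set (Site P j))) →
      Small expMeanLogSU (Averaging.iter (fun j => blockAvg (P := P) (j := j) expMeanLogSU) j' U) c') :
    iterMh j (coeField U) c = coeField (Averaging.iter (fun j => blockAvg (P := P) (j := j) expMeanLogSU) j U) c :=
  iterMh_coeField_apply_eq_of_guardOn j hj (preimage_blockIter_saturated hj _) hg c (self_mem_bondsIn_towerRegion hj c)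

/-- ★★ **THE HOLOMORPHIC ITERATE AT `c` IS ℂ-DIFFERENTIABLE AT EVERY MATRIX FIELD MATCHING `↑U` ON THE TOWER OF `c`, UNDER THE GUARD OF `U` ALONG THAT TOWER ONLY**
(`B15AveragingHolomorphicLocal.differentiableAt_iterMh_apply_of_guardOn` at the tower region).  This is the per-constrained-bond replacement of
`B15AveragingHolomorphic.differentiableAt_iterMh` (global `SmallBelow`) for the N12 producer of (J0′). [cite: Balaban1987RG1, (0.4) p.253 («analytic function»), (0.21) p.256; Balaban1985Variational, Prop. 9 (190) p.309] -/
theorem differentiableAt_iterMh_apply_of_guardOn_towerRegion (hj : j ≤ P.m + P.K) {U : GaugeField P 0 (SU N)} (c : PBond P j)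
    (hg : ∀ j', j' < j → ∀ c' : PBond P (j' + 1), c' ∈ bondsIn (j' + 1) (blockIter j ⁻¹' ({c.src, c.tgt} : Set (Site P j))) →
      Small expMeanLogSU (Averaging.iter (fun j => blockAvg (P := P) (j := j) expMeanLogSU) j' U) c')
    {V₀ : PBond P 0 → Matrix (Fin N) (Fin N) ℂ}
    (hV₀ : ∀ b : PBond P 0, b ∈ bondsIn 0 (blockIter j ⁻¹' ({c.src, c.tgt} : Set (Site P j))) → V₀ b = coeField U b) :
    DifferentiableAt ℂ (fun V : PBond P 0 → Matrix (Fin N) (Fin N) ℂ => iterMh j V c) V₀ :=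
  differentiableAt_iterMh_apply_of_guardOn j hj (preimage_blockIter_saturated hj _) hg hV₀ c (self_mem_bondsIn_towerRegion hj c)

/-- **ENTRYWISE, ALONG A ℂ-DIFFERENTIABLE FAMILY** (the shape the (J0′) producer consumes; `B15AveragingHolomorphicLocal.differentiableAt_iterMh_apply_entry_of_guardOn` at the tower region).
[cite: Balaban1985Variational, Prop. 9 (190) p.309; Balaban1987RG1, (0.4) p.253] -/
theorem differentiableAt_iterMh_apply_entry_of_guardOn_towerRegion {X : Type*} [NormedAddCommGroup X] [NormedSpace ℂ X] (hj : j ≤ P.m + P.K)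
    {U : GaugeField P 0 (SU N)} (c : PBond P j)
    (hg : ∀ j', j' < j → ∀ c' : PBond P (j' + 1), c' ∈ bondsIn (j' + 1) (blockIter j ⁻¹' ({c.src, c.tgt} : Set (Site P j))) →
      Small expMeanLogSU (Averaging.iter (fun j => blockAvg (P := P) (j := j) expMeanLogSU) j' U) c')
    {V : X → PBond P 0 → Matrix (Fin N) (Fin N) ℂ} {x : X} (hV : DifferentiableAt ℂ V x)
    (hx : ∀ b : PBond P 0, b ∈ bondsIn 0 (blockIter j ⁻¹' ({c.src, c.tgt} : Set (Site P j))) → V x b = coeField U b) (a e : Fin N) :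
    DifferentiableAt ℂ (fun y => iterMh j (V y) c a e) x :=
  differentiableAt_iterMh_apply_entry_of_guardOn j hj (preimage_blockIter_saturated hj _) hg hV hx c (self_mem_bondsIn_towerRegion hj c) a e

/-- **PROXY FORM IN ρ5b's CURRENCY** (positive level): a proxy `U_p`, `SmallBelow (j+1) U_p`, agreeing with `U` on `feeds (j+1) c`, and a matrix field `V₀` agreeing with `↑U` on the
tower region's fine bonds ⇒ `V ↦ iterMh (j+1) V c` is ℂ-differentiable at `V₀`. [cite: Balaban1987RG1, (0.4) p.253; Balaban1985Variational, Prop. 9 (190) p.309; Balaban1988Convergent, (2.11) p.256] -/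
theorem differentiableAt_iterMh_apply_of_feedsProxy (hj : j + 1 ≤ P.m + P.K) {U Up : GaugeField P 0 (SU N)} (c : PBond P (j + 1))
    (hUp : SmallBelow (fun j => blockAvg (P := P) (j := j) expMeanLogSU) (j + 1) Up) (heq : ∀ b ∈ feeds (j + 1) c, Up b = U b)
    {V₀ : PBond P 0 → Matrix (Fin N) (Fin N) ℂ}
    (hV₀ : ∀ b : PBond P 0, b ∈ bondsIn 0 (blockIter (j + 1) ⁻¹' ({c.src, c.tgt} : Set (Site P (j + 1)))) → V₀ b = coeField U b) :
    DifferentiableAt ℂ (fun V : PBond P 0 → Matrix (Fin N) (Fin N) ℂ => iterMh (j + 1) V c) V₀ :=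
  differentiableAt_iterMh_apply_of_guardOn_towerRegion hj c (guardOn_towerRegion_of_feedsProxy hj c hUp heq) hV₀

end AtTower

end Literature.MathematicalPhysics.QuantumFieldTheory.Balaban1983to89.B15AveragingHolomorphicTowerRegion

end
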